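import Summits.BirchSwinnertonDyer.BirchSwinnertonDyer.Theorems.ResidualThetaTransportAtTwoThetaLayerLambdaCongruenceAtTwoHeckeAdjointHeckeCocycle
import HarnessLib

/-!
# Crux Kan⁺ `ThetaLayerLambdaCongruenceAtTwo` (stmt-BirchSwinnertonDyer-20688), line `birth` v14, SD floor, Hecke clause — brick «HA8a» part 2:
# the permutation cocycles of the TRANSPOSED representatives `(p 0; -Nj 1)`, `diag(1,p)` of `Γ₀(N) diag(p,1) Γ₀(N)`, and `T♯_p` on `Λ` through them
# (width seat bsd-wall-rtt-p3-w4 g7; `--supports stmt-BirchSwinnertonDyer-20688`; THEOREMS ONLY — no `def`, no named fact, no `sorry`)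

HONEST FRAMING. Elementary THEOREMS about `2×2` integer matrices, `Γ₀(N)` and the tree's period functionals; nothing about any curve is
asserted; nothing here settles Kan⁺; BSD is not proved by any of this.

WHAT. Fricke conjugation `X ↦ w_N X w_N⁻¹ = (t, -z/N; -Ny, x)` of `X = (x y; z t)` (`N ∣ z`) maps the representatives `M_j = (1 j; 0 p)`,
`M_∞ = diag(p,1)` of `Γ₀(N) diag(1,p) Γ₀(N)` to `M̃_j = (p 0; -Nj 1)`, `M̃_∞ = diag(1,p)` — right-coset representatives of the TRANSPOSED double coset
`Γ₀(N) diag(p,1) Γ₀(N)` — and `Γ₀(N)` to itself. Conjugating the cocycle of part 1 (`exists_heckeCocycle_fin/option`, applied to the Fricke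
conjugate `γʷ`) gives (`exists_transposeHeckeCocycle_fin/option`): a PERMUTATION `σ` and `ε_i ∈ Γ₀(N)` with `M̃_i · γ = ε_i · M̃_{σ i}` in `M₂(ℤ)`,
TOGETHER WITH the identity `↑(Σ_i ⟨{∞, ε_i ∞}⟩) = T♯_p^∨ {∞, γ∞}` in `S₂(Γ₀(N))^∨` (`T♯_p = [Γ₀(N) diag(p,1) Γ₀(N)]`; rtt-p3-w4 g7's
`dualMap_transposeHeckeT_periodFunctional_eq_sum`) — i.e. the element `x' := Σ_i ⟨{∞, ε_i∞}⟩ ∈ Λ` is the witness required by the hypothesis of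
`exists_perfect_balanced_of_flippedTransposeAdjoint` («flip») / `exists_perfect_balanced_of_transposeAdjoint` («keep»), with its cocycle in
the (σ, δ)-encoding of rtt-p3-w3 g11's `sum_dualChainVec_anchor` and lead g13's `exists_maninChains_of_cocycle`. The conjugation is carried out
in `M₂(ℚ)` (`map_frickeConj_eq`) and pulled back to `ℤ` by injectivity of the cast.

References: F. Diamond, J. Shurman (2005) (5.2), Ex. 5.5.1 [DiamondShurman2005]; A. O. L. Atkin, J. Lehner (1970) §2 [AtkinLehner1970];
L. Merel (1995) §2.3 [Merel1995Homologie].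
-/

set_option autoImplicit false
-- justification: the `Summit.BirchSwinnertonDyer.BirchSwinnertonDyer.…` path repeats a component (route-file convention)
set_option linter.dupNamespace false

noncomputable section

open scoped MatrixGroups ModularForm

open CongruenceSubgroup Matrix.SpecialLinearGroup ModularGroup
open Literature.NumberTheory.EllipticCurves Literature.NumberTheory.EllipticCurves.ModularForms

namespace Summit.BirchSwinnertonDyer.BirchSwinnertonDyer.Theorems.ThetaLayerLambdaCongruenceAtTwo

/-! ## §1 Fricke conjugation of integer matrices, computed in `M₂(ℚ)` -/

section FrickeConj

variable (N : ℕ) [NeZero N]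

/-- **Fricke conjugation in `M₂(ℚ)`**: if the integer matrices `X = (x y; z t)` and `Y` satisfy `Y₀₀ = t`, `N·Y₀₁ = -z`, `Y₁₀ = -N y`,
`Y₁₁ = x` (i.e. `Y = w_N X w_N⁻¹` with `w_N = (0 -1; N 0)`), then `Y = w_N · X · w_N⁻¹` as rational matrices, `w_N⁻¹ = (0 1/N; -1 0)`.
[cite: AtkinLehner1970, §2] -/
theorem map_frickeConj_eq {X Y : Matrix (Fin 2) (Fin 2) ℤ} (h00 : Y 0 0 = X 1 1) (h01 : (N : ℤ) * Y 0 1 = -X 1 0)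
    (h10 : Y 1 0 = -((N : ℤ) * X 0 1)) (h11 : Y 1 1 = X 0 0) :
    Y.map (Int.castRingHom ℚ) =
      !![(0 : ℚ), -1; (N : ℚ), 0] * X.map (Int.castRingHom ℚ) * !![(0 : ℚ), ((N : ℚ))⁻¹; -1, 0] := by
  have hN : (N : ℚ) ≠ 0 := by exact_mod_cast NeZero.ne N
  have e01 : ((Y 0 1 : ℤ) : ℚ) = -((X 1 0 : ℤ) : ℚ) * ((N : ℚ))⁻¹ := by
    have e : ((N : ℤ) : ℚ) * ((Y 0 1 : ℤ) : ℚ) = -((X 1 0 : ℤ) : ℚ) := by exact_mod_cast h01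
    field_simp
    push_cast at e
    linear_combination e
  ext a b
  fin_cases a <;> fin_cases b <;> simp only [Matrix.map_apply, Matrix.mul_apply, Fin.sum_univ_two] <;>
    simp [h00, h10, h11, e01]
  -- the `(1,1)` entry `x = N x N⁻¹` remains
  field_simp

/-- `w_N⁻¹ · w_N = 1` in `M₂(ℚ)`. [folklore] -/
theorem frickeInvQ_mul_frickeQ :
    !![(0 : ℚ), ((N : ℚ))⁻¹; -1, 0] * !![(0 : ℚ), -1; (N : ℚ), 0] = 1 := by
  have hN : (N : ℚ) ≠ 0 := by exact_mod_cast NeZero.ne N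
  ext a b
  fin_cases a <;> fin_cases b <;> simp [Matrix.mul_apply, Fin.sum_univ_two, hN]

/-- Products of Fricke conjugates: `(w A w⁻¹)(w B w⁻¹) = w (A B) w⁻¹` in `M₂(ℚ)`. [folklore] -/
theorem frickeConjQ_mul (A B : Matrix (Fin 2) (Fin 2) ℤ) :
    (!![(0 : ℚ), -1; (N : ℚ), 0] * A.map (Int.castRingHom ℚ) * !![(0 : ℚ), ((N : ℚ))⁻¹; -1, 0]) *
      (!![(0 : ℚ), -1; (N : ℚ), 0] * B.map (Int.castRingHom ℚ) * !![(0 : ℚ), ((N : ℚ))⁻¹; -1, 0]) =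
      !![(0 : ℚ), -1; (N : ℚ), 0] * (A * B).map (Int.castRingHom ℚ) * !![(0 : ℚ), ((N : ℚ))⁻¹; -1, 0] := by
  rw [Matrix.map_mul]
  simp only [Matrix.mul_assoc]
  rw [← Matrix.mul_assoc (!![(0 : ℚ), ((N : ℚ))⁻¹; -1, 0]) (!![(0 : ℚ), -1; (N : ℚ), 0]), frickeInvQ_mul_frickeQ, Matrix.one_mul]

/-- **Conjugating a cocycle equation**: from `M γ₀ = δ M'` in `M₂(ℤ)` and Fricke-conjugate data `M ↦ M̃`, `γ₀ ↦ γ`, `δ ↦ ε`, `M' ↦ M̃'`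
(each in the entrywise sense of `map_frickeConj_eq`), `M̃ γ = ε M̃'` in `M₂(ℤ)`. [cite: AtkinLehner1970, §2] -/
theorem frickeConj_cocycle {M M' Mt Mt' : Matrix (Fin 2) (Fin 2) ℤ} {γ₀ γ δ ε : Matrix (Fin 2) (Fin 2) ℤ}
    (hM : Mt.map (Int.castRingHom ℚ) = !![(0 : ℚ), -1; (N : ℚ), 0] * M.map (Int.castRingHom ℚ) * !![(0 : ℚ), ((N : ℚ))⁻¹; -1, 0])
    (hM' : Mt'.map (Int.castRingHom ℚ) = !![(0 : ℚ), -1; (N : ℚ), 0] * M'.map (Int.castRingHom ℚ) * !![(0 : ℚ), ((N : ℚ))⁻¹; -1, 0])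
    (hγ : γ.map (Int.castRingHom ℚ) = !![(0 : ℚ), -1; (N : ℚ), 0] * γ₀.map (Int.castRingHom ℚ) * !![(0 : ℚ), ((N : ℚ))⁻¹; -1, 0])
    (hε : ε.map (Int.castRingHom ℚ) = !![(0 : ℚ), -1; (N : ℚ), 0] * δ.map (Int.castRingHom ℚ) * !![(0 : ℚ), ((N : ℚ))⁻¹; -1, 0])
    (hcoc : M * γ₀ = δ * M') :
    Mt * γ = ε * Mt' := by
  apply Matrix.map_injective (f := (Int.castRingHom ℚ : ℤ → ℚ)) Int.cast_injective
  change (Mt * γ).map (Int.castRingHom ℚ) = (ε * Mt').map (Int.castRingHom ℚ)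
  rw [Matrix.map_mul, Matrix.map_mul, hM, hγ, hε, hM', frickeConjQ_mul, frickeConjQ_mul, hcoc]

/-- The Fricke conjugate of `(1 j; 0 p)` is `(p 0; -Nj 1)`. [cite: DiamondShurman2005, Ex. 5.5.1] -/
theorem map_frickeConj_tpB (p : ℕ) (j : ℤ) :
    (!![(p : ℤ), 0; -((N : ℤ) * j), 1]).map (Int.castRingHom ℚ) =
      !![(0 : ℚ), -1; (N : ℚ), 0] * (!![(1 : ℤ), j; 0, (p : ℤ)]).map (Int.castRingHom ℚ) * !![(0 : ℚ), ((N : ℚ))⁻¹; -1, 0] :=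
  map_frickeConj_eq N rfl (by simp) (by simp) rfl

/-- The Fricke conjugate of `diag(p, 1)` is `diag(1, p)`. [cite: DiamondShurman2005, Ex. 5.5.1] -/
theorem map_frickeConj_tpD (p : ℕ) :
    (!![(1 : ℤ), 0; 0, (p : ℤ)]).map (Int.castRingHom ℚ) =
      !![(0 : ℚ), -1; (N : ℚ), 0] * (!![(p : ℤ), 0; 0, 1]).map (Int.castRingHom ℚ) * !![(0 : ℚ), ((N : ℚ))⁻¹; -1, 0] :=
  map_frickeConj_eq N rfl (by simp) (by simp) rfl

/-- The Fricke conjugate of `γ ∈ SL₂(ℤ)` with the entries of `exists_frickeConj_explicit`. [cite: AtkinLehner1970, §2] -/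
theorem map_frickeConj_sl {γ γ' : SL(2, ℤ)} (h00 : γ' 0 0 = γ 1 1) (h01 : (N : ℤ) * γ' 0 1 = -(γ 1 0))
    (h10 : γ' 1 0 = -((N : ℤ) * γ 0 1)) (h11 : γ' 1 1 = γ 0 0) :
    (γ' : Matrix (Fin 2) (Fin 2) ℤ).map (Int.castRingHom ℚ) =
      !![(0 : ℚ), -1; (N : ℚ), 0] * (γ : Matrix (Fin 2) (Fin 2) ℤ).map (Int.castRingHom ℚ) * !![(0 : ℚ), ((N : ℚ))⁻¹; -1, 0] :=
  map_frickeConj_eq N h00 h01 h10 h11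

omit [NeZero N] in
/-- The Fricke conjugate of a Fricke conjugate is the original matrix (`w_N² = -N` is central): if `γ'` has the conjugate entries of `γ`,
then `γ` has the conjugate entries of `γ'`. [cite: AtkinLehner1970, Lemma 7] -/
theorem frickeConj_entries_symm {γ γ' : SL(2, ℤ)} (h00 : γ' 0 0 = γ 1 1) (h01 : (N : ℤ) * γ' 0 1 = -(γ 1 0))
    (h10 : γ' 1 0 = -((N : ℤ) * γ 0 1)) (h11 : γ' 1 1 = γ 0 0) :
    γ 0 0 = γ' 1 1 ∧ (N : ℤ) * γ 0 1 = -(γ' 1 0) ∧ γ 1 0 = -((N : ℤ) * γ' 0 1) ∧ γ 1 1 = γ' 0 0 := by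
  refine ⟨h11.symm, by rw [h10, neg_neg], by rw [h01, neg_neg], h00.symm⟩

/-- On `ℍ`, `w ∘ γ = γ' ∘ w` implies `w ∘ γ' = γ ∘ w` (`w ∘ w = id` on `ℍ`, `frickeGL_smul_frickeGL_smul`). [cite: AtkinLehner1970, Lemma 7] -/
theorem frickeConj_smul_symm {γ γ' : Gamma0 N}
    (hconj : ∀ τ : UpperHalfPlane, glCast (frickeGL N : GL (Fin 2) ℚ) • ((γ : SL(2, ℤ)) • τ) =
      (γ' : SL(2, ℤ)) • (glCast (frickeGL N : GL (Fin 2) ℚ) • τ)) (τ : UpperHalfPlane) :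
    glCast (frickeGL N : GL (Fin 2) ℚ) • ((γ' : SL(2, ℤ)) • τ) = (γ : SL(2, ℤ)) • (glCast (frickeGL N : GL (Fin 2) ℚ) • τ) := by
  have h := hconj (glCast (frickeGL N : GL (Fin 2) ℚ) • τ)
  rw [frickeGL_smul_frickeGL_smul] at h
  rw [← h, frickeGL_smul_frickeGL_smul]

end FrickeConj

/-! ## §2 The transposed cocycles and `T♯_p` on `Λ` -/

section TransposeCocycle

variable (N : ℕ) [NeZero N] {p : ℕ} (hp : p.Prime)
include hp

/-- **Transposed Hecke cocycle, `p ∤ N`** (index set `Option (Fin p)`: `some j ↦ M̃_j = (p 0; -Nj 1)`, `none ↦ M̃_∞ = diag(1, p)` — right-coset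
representatives of `Γ₀(N) diag(p,1) Γ₀(N)`): for `γ ∈ Γ₀(N)` there are a permutation `σ` and `ε_i ∈ Γ₀(N)` with `M̃_i · γ = ε_i · M̃_{σ i}` in
`M₂(ℤ)`, AND `Σ_i {∞, ε_i∞} = T♯_p^∨ {∞, γ∞}` — the element `Σ_i ⟨{∞, ε_i∞}⟩ ∈ Λ` underlies `[Γ₀(N) diag(p,1) Γ₀(N)]^∨ {∞, γ∞}`.
[cite: DiamondShurman2005, (5.2) and Ex. 5.5.1] [cite: Merel1995Homologie, §2.3] -/
theorem exists_transposeHeckeCocycle_option (hpN : ¬ p ∣ N) (γ : Gamma0 N) :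
    ∃ (σ : Equiv.Perm (Option (Fin p))) (ε : Option (Fin p) → Gamma0 N),
      (∀ i : Option (Fin p),
        (i.elim !![(1 : ℤ), 0; 0, (p : ℤ)] fun j ↦ !![(p : ℤ), 0; -((N : ℤ) * ((j : ℕ) : ℤ)), 1]) *
            ((γ : SL(2, ℤ)) : Matrix (Fin 2) (Fin 2) ℤ) =
          (((ε i : Gamma0 N) : SL(2, ℤ)) : Matrix (Fin 2) (Fin 2) ℤ) *
            ((σ i).elim !![(1 : ℤ), 0; 0, (p : ℤ)] fun j ↦ !![(p : ℤ), 0; -((N : ℤ) * ((j : ℕ) : ℤ)), 1])) ∧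
      (((∑ i : Option (Fin p), (⟨periodFunctional N (ε i), periodFunctional_mem_periodHomology N (ε i)⟩ : periodHomologyHecke N)) :
          periodHomologyHecke N) : Module.Dual ℂ (CuspForm (Gamma0 N) 2)) =
        (haveI : NeZero p := ⟨hp.ne_zero⟩;
          (cuspHeckeOperatorₗ (Gamma0 N) 2 (diagGL p 1 (Nat.cast_pos.mpr (NeZero.pos p)) one_pos)).dualMap (periodFunctional N γ)) := by
  haveI : NeZero p := ⟨hp.ne_zero⟩
  have hpz : (p : ℤ) ≠ 0 := by exact_mod_cast hp.ne_zero
  -- the Fricke conjugate `γ₀` of `γ` (so that `γ` is the conjugate of `γ₀`)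
  obtain ⟨γ₀, hconj₀, g00, g01, g10, g11⟩ := exists_frickeConj_explicit N γ
  obtain ⟨e00, e01, e10, e11⟩ := frickeConj_entries_symm N (γ := (γ : SL(2, ℤ))) (γ' := (γ₀ : SL(2, ℤ))) g00 g01 g10 g11
  have hγ := map_frickeConj_sl N (γ := (γ₀ : SL(2, ℤ))) (γ' := (γ : SL(2, ℤ))) e00 e01 e10 e11
  -- the `T_p`-cocycle of `γ₀` and the Fricke conjugates `ε i` of its `δ i`
  obtain ⟨σ, δ, hcoc⟩ := exists_heckeCocycle_option N hp hpN γ₀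
  have hεex := fun i : Option (Fin p) ↦ exists_frickeConj_explicit N (δ i)
  choose ε hεconj hε00 hε01 hε10 hε11 using hεex
  have hε := fun i : Option (Fin p) ↦
    map_frickeConj_sl N (γ := ((δ i : Gamma0 N) : SL(2, ℤ))) (γ' := ((ε i : Gamma0 N) : SL(2, ℤ))) (hε00 i) (hε01 i) (hε10 i) (hε11 i)
  -- conjugates of the representatives
  have hM : ∀ i : Option (Fin p),
      (i.elim !![(1 : ℤ), 0; 0, (p : ℤ)] fun j ↦ !![(p : ℤ), 0; -((N : ℤ) * ((j : ℕ) : ℤ)), 1]).map (Int.castRingHom ℚ) =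
        !![(0 : ℚ), -1; (N : ℚ), 0] * (i.elim !![(p : ℤ), 0; 0, 1] fun j ↦ !![(1 : ℤ), ((j : ℕ) : ℤ); 0, (p : ℤ)]).map (Int.castRingHom ℚ) *
          !![(0 : ℚ), ((N : ℚ))⁻¹; -1, 0] := by
    rintro (_ | j)
    · exact map_frickeConj_tpD N p
    · exact map_frickeConj_tpB N p ((j : ℕ) : ℤ)
  refine ⟨σ, ε, fun i ↦ frickeConj_cocycle N (hM i) (hM (σ i)) hγ (hε i) (hcoc i), ?_⟩
  -- `T♯_p^∨ {∞, γ∞}` through the conjugates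
  have h10 : ∀ i : Option (Fin p), (i.elim !![(p : ℤ), 0; 0, 1] fun j ↦ !![(1 : ℤ), ((j : ℕ) : ℤ); 0, (p : ℤ)]) 1 0 = 0 := by
    rintro (_ | j) <;> rfl
  have h00 : ∀ i : Option (Fin p), (i.elim !![(p : ℤ), 0; 0, 1] fun j ↦ !![(1 : ℤ), ((j : ℕ) : ℤ); 0, (p : ℤ)]) 0 0 ≠ 0 := by
    rintro (_ | j)
    · exact hpz
    · exact one_ne_zero
  have hB := fun j : Fin p ↦
    cusps_of_cocycle_tpB hp (γ := (γ₀ : SL(2, ℤ))) (δ := ((δ (some j) : Gamma0 N) : SL(2, ℤ)))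
      (Mσ := (σ (some j)).elim !![(p : ℤ), 0; 0, 1] fun j ↦ !![(1 : ℤ), ((j : ℕ) : ℤ); 0, (p : ℤ)]) ((j : ℕ) : ℤ)
      (h10 _) (h00 _) (hcoc (some j))
  have hD := cusps_of_cocycle_tpD (p := p) (γ := (γ₀ : SL(2, ℤ))) (δ := ((δ none : Gamma0 N) : SL(2, ℤ)))
      (Mσ := (σ none).elim !![(p : ℤ), 0; 0, 1] fun j ↦ !![(1 : ℤ), ((j : ℕ) : ℤ); 0, (p : ℤ)]) (h10 _) (h00 _) (hcoc none)
  have key := dualMap_transposeHeckeT_periodFunctional_eq_sum N hp γ γ₀ hconj₀ (fun j ↦ δ (some j)) (δ none)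
    (fun j ↦ (hB j).1) (fun j ↦ (hB j).2) (fun _ ↦ hD.1) (fun _ ↦ hD.2) (fun j ↦ ε (some j)) (ε none)
    (fun j ↦ hεconj (some j)) (fun _ ↦ hεconj none)
  rw [key, if_neg hpN, Submodule.coe_sum, Fintype.sum_option, add_comm]

/-- **Transposed Hecke cocycle, `p ∣ N`** (index set `Fin p`, `M̃_j = (p 0; -Nj 1)`): a permutation `σ` and `ε_j ∈ Γ₀(N)` with
`M̃_j · γ = ε_j · M̃_{σ j}` in `M₂(ℤ)`, AND `Σ_j {∞, ε_j∞} = T♯_p^∨ {∞, γ∞}` (`= (w U_p w)^∨ {∞, γ∞}`).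
[cite: DiamondShurman2005, (5.2) and Ex. 5.5.1] [cite: Merel1995Homologie, §2.3] -/
theorem exists_transposeHeckeCocycle_fin (hpN : p ∣ N) (γ : Gamma0 N) :
    ∃ (σ : Equiv.Perm (Fin p)) (ε : Fin p → Gamma0 N),
      (∀ j : Fin p,
        !![(p : ℤ), 0; -((N : ℤ) * ((j : ℕ) : ℤ)), 1] * ((γ : SL(2, ℤ)) : Matrix (Fin 2) (Fin 2) ℤ) =
          (((ε j : Gamma0 N) : SL(2, ℤ)) : Matrix (Fin 2) (Fin 2) ℤ) * !![(p : ℤ), 0; -((N : ℤ) * (((σ j : Fin p) : ℕ) : ℤ)), 1]) ∧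
      (((∑ j : Fin p, (⟨periodFunctional N (ε j), periodFunctional_mem_periodHomology N (ε j)⟩ : periodHomologyHecke N)) :
          periodHomologyHecke N) : Module.Dual ℂ (CuspForm (Gamma0 N) 2)) =
        (haveI : NeZero p := ⟨hp.ne_zero⟩;
          (cuspHeckeOperatorₗ (Gamma0 N) 2 (diagGL p 1 (Nat.cast_pos.mpr (NeZero.pos p)) one_pos)).dualMap (periodFunctional N γ)) := by
  haveI : NeZero p := ⟨hp.ne_zero⟩
  obtain ⟨γ₀, hconj₀, g00, g01, g10, g11⟩ := exists_frickeConj_explicit N γ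
  obtain ⟨e00, e01, e10, e11⟩ := frickeConj_entries_symm N (γ := (γ : SL(2, ℤ))) (γ' := (γ₀ : SL(2, ℤ))) g00 g01 g10 g11
  have hγ := map_frickeConj_sl N (γ := (γ₀ : SL(2, ℤ))) (γ' := (γ : SL(2, ℤ))) e00 e01 e10 e11
  obtain ⟨σ, δ, hcoc⟩ := exists_heckeCocycle_fin N hp hpN γ₀
  have hεex := fun j : Fin p ↦ exists_frickeConj_explicit N (δ j)
  choose ε hεconj hε00 hε01 hε10 hε11 using hεex
  have hε := fun j : Fin p ↦
    map_frickeConj_sl N (γ := ((δ j : Gamma0 N) : SL(2, ℤ))) (γ' := ((ε j : Gamma0 N) : SL(2, ℤ))) (hε00 j) (hε01 j) (hε10 j) (hε11 j)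
  refine ⟨σ, ε, fun j ↦ frickeConj_cocycle N (map_frickeConj_tpB N p ((j : ℕ) : ℤ))
    (map_frickeConj_tpB N p (((σ j : Fin p) : ℕ) : ℤ)) hγ (hε j) (hcoc j), ?_⟩
  have hB := fun j : Fin p ↦
    cusps_of_cocycle_tpB hp (γ := (γ₀ : SL(2, ℤ))) (δ := ((δ j : Gamma0 N) : SL(2, ℤ)))
      (Mσ := !![(1 : ℤ), (((σ j : Fin p) : ℕ) : ℤ); 0, (p : ℤ)]) ((j : ℕ) : ℤ) rfl (by simp) (hcoc j)
  have key := dualMap_transposeHeckeT_periodFunctional_eq_sum N hp γ γ₀ hconj₀ δ 1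
    (fun j ↦ (hB j).1) (fun j ↦ (hB j).2) (fun h ↦ (h hpN).elim) (fun h ↦ (h hpN).elim) ε 1
    (fun j ↦ hεconj j) (fun h ↦ (h hpN).elim)
  rw [key, if_pos hpN, add_zero, Submodule.coe_sum]

end TransposeCocycle

end Summit.BirchSwinnertonDyer.BirchSwinnertonDyer.Theorems.ThetaLayerLambdaCongruenceAtTwo

end
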